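import Summits.HubbardSuperconductivity.HubbardSuperconductivity.Theorems.AnisotropyChordFourTorusClasses
import Summits.HubbardSuperconductivity.HubbardSuperconductivity.Theorems.AnisotropyChordTowerDeficit

/-!
# Route `AnisotropyChord` / crux `FerroSideChord` at `M = 4`: THE CONDENSATE AND THE KINETIC FORM THROUGH THE WEIGHT-9 CODES
(prover seat `hubbard-h0-rotor-p1` g17)

For the sector-`0` Perron amplitude `a` of `H₄(Δ)` with class values `v r = a (decode (rep8 r))`:
* `lowerSum` (`S⁻_tot a`) lives on the weight-9 codes, is automorphism invariant, and at the representative `rep9 ρ` equals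
  `Σ_{c ∈ children ρ} v c`; hence **`lowerNormSq_eq_classes`**: `‖S⁻_tot a‖² = Σ_{ρ<56} n9 ρ (Σ_{c ∈ children ρ} v c)²`;
* the graph (kinetic) form: `pair_sum_rewrite` turns `Σ_σ (a σ − a σ^{xy})²` into a sum over configurations containing
  both `x` and `y`; **`inner_fmOp_eq_classes`**: `Σ_σ a (A a) = ¼ Σ_{ρ<56} n9 ρ Σ_{(p,q) ∈ ordPairs ρ} (v p − v q)²`.
-/

set_option linter.style.longLine false
set_option linter.dupNamespace false
set_option autoImplicit false

open Finset
open Literature.MathematicalPhysics.QuantumLattice Literature.Probability.LatticeModels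
open Summit.HubbardSuperconductivity.HubbardSuperconductivity.Theorems.AnisotropyChord.Tower
open Summit.HubbardSuperconductivity.HubbardSuperconductivity.Theorems.AnisotropyChord.InsertionEntropy

namespace Summit.HubbardSuperconductivity.HubbardSuperconductivity.Theorems.AnisotropyChord.FourTorus

/-! ## List sums over `List.range` -/

/-- `((List.range n).map F).sum = Σ_{i<n} F i`. [folklore] -/
theorem list_sum_range {β : Type} [AddCommMonoid β] (F : ℕ → β) (n : ℕ) :
    ((List.range n).map F).sum = ∑ i ∈ range n, F i := by
  induction n with
  | zero => simp
  | succ n ih => rw [List.range_succ, List.map_append, List.sum_append, ih, Finset.sum_range_succ]; simp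

/-- sum over a `filterMap`. [folklore] -/
theorem list_sum_filterMap {α β : Type} [AddCommMonoid β] (l : List α) (h : α → Option ℕ) (g : ℕ → β) :
    ((l.filterMap h).map g).sum = (l.map fun j => (h j).elim 0 g).sum := by
  induction l with
  | nil => simp
  | cons x l ih =>
    rw [List.filterMap_cons, List.map_cons, List.sum_cons]
    cases hx : h x with
    | none => simp [ih]
    | some c => simp [ih]

/-- sum over a `filterMap` of pairs. [folklore] -/
theorem list_sum_filterMap₂ {α β : Type} [AddCommMonoid β] (l : List α) (h : α → Option (ℕ × ℕ)) (g : ℕ × ℕ → β) :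
    ((l.filterMap h).map g).sum = (l.map fun j => (h j).elim 0 g).sum := by
  induction l with
  | nil => simp
  | cons x l ih =>
    rw [List.filterMap_cons, List.map_cons, List.sum_cons]
    cases hx : h x with
    | none => simp [ih]
    | some c => simp [ih]

/-- sum over a `flatMap`. [folklore] -/
theorem list_sum_flatMap {α γ β : Type} [AddCommMonoid β] (l : List α) (f : α → List γ) (g : γ → β) :
    ((l.flatMap f).map g).sum = (l.map fun i => ((f i).map g).sum).sum := by
  induction l with
  | nil => simp
  | cons x l ih => rw [List.flatMap_cons, List.map_append, List.sum_append, ih, List.map_cons, List.sum_cons]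

/-! ## Representatives of the weight-9 classes -/

/-- clearing a set bit of a code = removing the particle: `update (decode u) x 0 = decode (u ^^^ 2^{e x})`. [folklore] -/
theorem decode_clearBit (u : ℕ) (x : V4) (hx : Nat.testBit u (siteEquiv x) = true) :
    Function.update (decode u) x 0 = decode (u ^^^ 2 ^ (siteEquiv x : ℕ)) := by
  funext z
  by_cases hz : z = x
  · subst hz
    rw [Function.update_self]
    symm
    rw [decode_eq_zero_iff, Nat.testBit_xor, hx, Nat.testBit_two_pow_self]; rfl
  · rw [Function.update_of_ne hz]
    unfold decode
    have hne : (siteEquiv x : ℕ) ≠ (siteEquiv z : ℕ) := fun h => hz (siteEquiv.injective (Fin.ext h)).symm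
    rw [Nat.testBit_xor, Nat.testBit_two_pow]
    simp [hne]

/-- removing a particle raises the number of zeros by one. [folklore] -/
theorem zerosCard_update_zero {V : Type} [Fintype V] [DecidableEq V] (τ : V → Fin 2) (y : V) (hy : τ y = 1) :
    zerosCard (Function.update τ y 0) = zerosCard τ + 1 := by
  unfold zerosCard
  have hset : (univ.filter fun x => Function.update τ y 0 x = 0) = insert y (univ.filter fun x => τ x = 0) := by
    ext x
    simp only [Finset.mem_filter, Finset.mem_univ, true_and, Finset.mem_insert]
    by_cases hx : x = y
    · subst hx; simp
    · rw [Function.update_of_ne hx]; simp [hx]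
  have hnot : y ∉ (univ.filter fun x => τ x = 0) := by simp [hy]
  rw [hset, Finset.card_insert_of_notMem hnot]
  push_cast; ring

/-! ## `S⁻_tot a` in class variables -/

section General
variable {V : Type} [Fintype V] [DecidableEq V]

/-- `lowerSum` of an automorphism-invariant amplitude is automorphism invariant. [folklore] -/
theorem lowerSum_comp_equiv (φ : V ≃ V) (a : (V → Fin 2) → ℝ) (ha : ∀ σ, a (σ ∘ φ) = a σ) (τ : V → Fin 2) :
    lowerSum a (τ ∘ φ) = lowerSum a τ := by
  unfold lowerSum
  have key : ∀ x, (if (τ ∘ φ) x = 1 then a (Function.update (τ ∘ φ) x 0) else 0)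
      = (fun y => if τ y = 1 then a (Function.update τ y 0) else 0) (φ x) := by
    intro x
    have hupd : Function.update (τ ∘ φ) x 0 = Function.update τ (φ x) 0 ∘ φ := by
      rw [Function.update_comp_equiv τ φ (φ x) 0, Equiv.symm_apply_apply]
    simp only [Function.comp_apply, hupd, ha]
  rw [Finset.sum_congr rfl (fun x _ => key x)]
  exact Equiv.sum_comp φ (fun y => if τ y = 1 then a (Function.update τ y 0) else 0)

end General

/-- `lowerSum a` vanishes off the weight-9 codes (`a` the sector-`0` amplitude). [folklore] -/
theorem lowerSum_decode_eq_zero {Δ : ℝ} {a : Cfg → ℝ} (ha : IsPerronSectorGroundAmplitude 4 Δ 0 a) {k : ℕ} (hk : k < 65536)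
    (hpop : pop16 k ≠ 9) : lowerSum a (decode k) = 0 := by
  unfold lowerSum
  refine Finset.sum_eq_zero fun x _ => ?_
  split_ifs with hx
  · by_contra hne
    have h8 := perron_support ha _ hne
    rw [zerosCard_update_zero _ _ hx, zerosCard_decode, card_V4, ← pop16_eq_bitCount k hk] at h8
    push_cast at h8
    have : (pop16 k : ℝ) = 9 := by linarith
    exact hpop (by exact_mod_cast this)
  · rfl

/-- `lowerSum a` is a class function on the weight-9 codes. [folklore] -/
theorem lowerSum_decode_class {Δ : ℝ} {a : Cfg → ℝ} (ha : IsPerronSectorGroundAmplitude 4 Δ 0 a) {k : ℕ} (hk : k < 65536)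
    (hpop : pop16 k = 9) : lowerSum a (decode k) = lowerSum a (decode (rep9 (cls9 k))) := by
  obtain ⟨-, hw, he, hact⟩ := check9_facts hk hpop
  conv_lhs => rw [← hact]
  exact decode_actCode_even_comp (lowerSum a)
    (fun φ σ => lowerSum_comp_equiv φ.toEquiv a (fun τ => perronAmplitude_comp_iso 4 Δ 0 a ha φ τ) σ) hw he _

/-- at the representative: `lowerSum a (decode (rep9 ρ)) = Σ_{c ∈ children ρ} v c`. [folklore] -/
theorem lowerSum_decode_rep9 {Δ : ℝ} {a : Cfg → ℝ} (ha : IsPerronSectorGroundAmplitude 4 Δ 0 a) {ρ : ℕ} (hρ : ρ < 56) :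
    lowerSum a (decode (rep9 ρ)) = ((children ρ).map fun c => a (decode (rep8 c))).sum := by
  obtain ⟨-, -, -, hch⟩ := rep9_facts hρ
  unfold children lowerSum
  rw [list_sum_filterMap, list_sum_range, ← sum_V4_eq]
  refine Finset.sum_congr rfl fun x _ => ?_
  by_cases hx : Nat.testBit (rep9 ρ) (siteEquiv x) = true
  · obtain ⟨hp8, hlt⟩ := hch (siteEquiv x) (siteEquiv x).isLt hx
    rw [if_pos ((decode_eq_one_iff _ _).2 hx), hx, cond_true, Option.elim_some, decode_clearBit _ _ hx, classValue ha hlt hp8]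
  · have hx' : Nat.testBit (rep9 ρ) (siteEquiv x) = false := by simpa using hx
    rw [if_neg (fun h => hx ((decode_eq_one_iff _ _).1 h)), hx', cond_false, Option.elim_none]

/-- **the condensate in class variables:** `‖S⁻_tot a‖² = Σ_{ρ<56} n9 ρ · (Σ_{c ∈ children ρ} v c)²`. [folklore] -/
theorem lowerNormSq_eq_classes {Δ : ℝ} {a : Cfg → ℝ} (ha : IsPerronSectorGroundAmplitude 4 Δ 0 a) :
    lowerNormSq a = ∑ ρ ∈ range 56, (n9 ρ : ℝ) * ((children ρ).map fun c => a (decode (rep8 c))).sum ^ 2 := by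
  unfold lowerNormSq
  rw [sum_config_eq_sum_range, ← sum_sector9]
  refine Finset.sum_congr rfl fun k hk => ?_
  have hk' := mem_range.1 hk
  by_cases hp : pop16 k = 9
  · rw [if_pos hp, lowerSum_decode_class ha hk' hp, lowerSum_decode_rep9 ha (check9_facts hk' hp).1]
  · rw [if_neg hp, lowerSum_decode_eq_zero ha hk' hp]; ring

/-! ## The graph form through configurations containing an adjacent pair -/

section PairRewrite
variable {V : Type} [Fintype V] [DecidableEq V]

omit [Fintype V] in
/-- hop from `(0,1)` at `(x,y)`: with `τ = update σ x 1` one has `σ = update τ x 0` and `σ ∘ swap = update τ y 0`. [folklore] -/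
theorem swap_eq_updates {σ : V → Fin 2} {x y : V} (hxy : x ≠ y) (hx : σ x = 0) (hy : σ y = 1) :
    σ ∘ ⇑(Equiv.swap x y) = Function.update (Function.update σ x 1) y 0 := by
  funext z
  simp only [Function.comp_apply]
  by_cases hzy : z = y
  · subst hzy; rw [Equiv.swap_apply_right, Function.update_self, hx]
  · rw [Function.update_of_ne hzy]
    by_cases hzx : z = x
    · subst hzx; rw [Equiv.swap_apply_left, Function.update_self, hy]
    · rw [Equiv.swap_apply_of_ne_of_ne hzx hzy, Function.update_of_ne hzx]

/-- **pair rewrite:** for `x ≠ y` and any amplitude,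
`Σ_σ (a σ − a (σ ∘ swap_{xy}))² = 2 Σ_τ [τ x = 1 ∧ τ y = 1] (a (τ − y) − a (τ − x))²`. [folklore] -/
theorem pair_sum_rewrite (a : (V → Fin 2) → ℝ) {x y : V} (hxy : x ≠ y) :
    ∑ σ, (a σ - a (σ ∘ ⇑(Equiv.swap x y))) ^ 2
      = 2 * ∑ τ : V → Fin 2, (if τ x = 1 ∧ τ y = 1 then (a (Function.update τ y 0) - a (Function.update τ x 0)) ^ 2 else 0) := by
  have fin2 : ∀ t : Fin 2, t = 0 ∨ t = 1 := by decide
  -- split each summand according to the occupations of `x` and `y`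
  set P : (V → Fin 2) → ℝ := fun τ => if τ x = 1 ∧ τ y = 1 then (a (Function.update τ y 0) - a (Function.update τ x 0)) ^ 2 else 0
    with hP
  have hsplit : ∀ σ : V → Fin 2, (a σ - a (σ ∘ ⇑(Equiv.swap x y))) ^ 2 = P (flipAt x σ) + P (flipAt y σ) := by
    intro σ
    rcases fin2 (σ x) with hx | hx <;> rcases fin2 (σ y) with hy | hy
    · -- (0,0): no hop
      rw [comp_swap_of_eq σ (hx.trans hy.symm), sub_self]
      have h1 : ¬ (flipAt x σ x = 1 ∧ flipAt x σ y = 1) := by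
        intro h; rw [flipAt_of_eq_zero hx, Function.update_of_ne (Ne.symm hxy)] at h; rw [hy] at h; exact absurd h.2 (by decide)
      have h2 : ¬ (flipAt y σ x = 1 ∧ flipAt y σ y = 1) := by
        intro h; rw [flipAt_of_eq_zero hy, Function.update_of_ne hxy] at h; rw [hx] at h; exact absurd h.1 (by decide)
      simp only [hP, h1, h2, if_false]; ring
    · -- (0,1): τ = flipAt x σ
      have hτ : flipAt x σ = Function.update σ x 1 := flipAt_of_eq_zero hx
      have h1 : flipAt x σ x = 1 ∧ flipAt x σ y = 1 := by
        rw [hτ, Function.update_self, Function.update_of_ne (Ne.symm hxy), hy]; exact ⟨rfl, rfl⟩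
      have h2 : ¬ (flipAt y σ x = 1 ∧ flipAt y σ y = 1) := by
        intro h; rw [flipAt_of_eq_one hy, Function.update_of_ne hxy, hx] at h; exact absurd h.1 (by decide)
      simp only [hP, h1, h2, if_false, if_true, and_self, add_zero]
      rw [hτ, swap_eq_updates hxy hx hy]
      have hσ : Function.update (Function.update σ x 1) x 0 = σ := by
        rw [Function.update_idem, ← hx, Function.update_eq_self]
      rw [hσ]; ring
    · -- (1,0): τ = flipAt y σ
      have hτ : flipAt y σ = Function.update σ y 1 := flipAt_of_eq_zero hy
      have h2 : flipAt y σ x = 1 ∧ flipAt y σ y = 1 := by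
        rw [hτ, Function.update_self, Function.update_of_ne hxy, hx]; exact ⟨rfl, rfl⟩
      have h1 : ¬ (flipAt x σ x = 1 ∧ flipAt x σ y = 1) := by
        intro h; rw [flipAt_of_eq_one hx, Function.update_of_ne (Ne.symm hxy), hy] at h; exact absurd h.2 (by decide)
      simp only [hP, h1, h2, if_false, if_true, and_self, zero_add]
      rw [hτ, Equiv.swap_comm, swap_eq_updates (Ne.symm hxy) hy hx]
      have hσ : Function.update (Function.update σ y 1) y 0 = σ := by
        rw [Function.update_idem, ← hy, Function.update_eq_self]
      rw [hσ]
    · -- (1,1): no hop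
      rw [comp_swap_of_eq σ (hx.trans hy.symm), sub_self]
      have h1 : ¬ (flipAt x σ x = 1 ∧ flipAt x σ y = 1) := by
        intro h; rw [flipAt_of_eq_one hx, Function.update_self] at h; exact absurd h.1 (by decide)
      have h2 : ¬ (flipAt y σ x = 1 ∧ flipAt y σ y = 1) := by
        intro h; rw [flipAt_of_eq_one hy, Function.update_self] at h; exact absurd h.2 (by decide)
      simp only [hP, h1, h2, if_false]; ring
  simp_rw [hsplit]
  rw [Finset.sum_add_distrib, ← sum_flip x P, ← sum_flip y P, two_mul]

end PairRewrite

/-- the pair (Dirichlet) form of a weight-9 configuration: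
`D(τ) = Σ_x Σ_y [x ∼ y, τ x = τ y = 1] (a (τ − y) − a (τ − x))²`. [folklore] -/
noncomputable def pairForm (a : Cfg → ℝ) (τ : Cfg) : ℝ :=
  ∑ x, ∑ y, if (torusGraph 2 4).Adj x y ∧ τ x = 1 ∧ τ y = 1 then (a (Function.update τ y 0) - a (Function.update τ x 0)) ^ 2 else 0

/-- **the graph form through configurations with an adjacent pair:** `Σ_σ a σ (A a)(σ) = ¼ Σ_τ D(τ)`. [folklore] -/
theorem inner_fmOp_eq_pairForm (a : Cfg → ℝ) :
    ∑ σ, a σ * fmOp (torusGraph 2 4) a σ = (1/4 : ℝ) * ∑ τ, pairForm a τ := by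
  rw [inner_fmOp_eq]
  unfold pairForm
  rw [Finset.sum_comm (s := (univ : Finset Cfg))]
  have inner : ∀ x : V4, (∑ y, if (torusGraph 2 4).Adj x y then ∑ σ, (a σ - a (σ ∘ ⇑(Equiv.swap x y))) ^ 2 else 0)
      = 2 * ∑ y, ∑ τ : Cfg, (if (torusGraph 2 4).Adj x y ∧ τ x = 1 ∧ τ y = 1
          then (a (Function.update τ y 0) - a (Function.update τ x 0)) ^ 2 else 0) := by
    intro x
    rw [Finset.mul_sum]
    refine Finset.sum_congr rfl fun y _ => ?_
    by_cases h : (torusGraph 2 4).Adj x y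
    · rw [if_pos h, pair_sum_rewrite a h.ne]
      congr 1
      exact Finset.sum_congr rfl fun τ _ => by simp only [h, true_and]
    · rw [if_neg h]
      simp [h]
  simp_rw [inner]
  rw [← Finset.mul_sum]
  have hcomm : ∀ x : V4, (∑ y, ∑ τ : Cfg, (if (torusGraph 2 4).Adj x y ∧ τ x = 1 ∧ τ y = 1
      then (a (Function.update τ y 0) - a (Function.update τ x 0)) ^ 2 else 0))
      = ∑ τ : Cfg, ∑ y, (if (torusGraph 2 4).Adj x y ∧ τ x = 1 ∧ τ y = 1
      then (a (Function.update τ y 0) - a (Function.update τ x 0)) ^ 2 else 0) := fun x => Finset.sum_comm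
  simp_rw [hcomm]
  rw [Finset.sum_comm (s := (univ : Finset V4))]
  ring

/-- the pair form vanishes off the weight-9 codes. [folklore] -/
theorem pairForm_decode_eq_zero {Δ : ℝ} {a : Cfg → ℝ} (ha : IsPerronSectorGroundAmplitude 4 Δ 0 a) {k : ℕ} (hk : k < 65536)
    (hpop : pop16 k ≠ 9) : pairForm a (decode k) = 0 := by
  unfold pairForm
  refine Finset.sum_eq_zero fun x _ => Finset.sum_eq_zero fun y _ => ?_
  split_ifs with h
  · obtain ⟨-, hx, hy⟩ := h
    have zero_of : ∀ z : V4, decode k z = 1 → a (Function.update (decode k) z 0) = 0 := by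
      intro z hz
      by_contra hne
      have h8 := perron_support ha _ hne
      rw [zerosCard_update_zero _ _ hz, zerosCard_decode, card_V4, ← pop16_eq_bitCount k hk] at h8
      push_cast at h8
      have : (pop16 k : ℝ) = 9 := by linarith
      exact hpop (by exact_mod_cast this)
    rw [zero_of y hy, zero_of x hx]; ring
  · rfl

/-- the pair form is automorphism invariant (for an automorphism-invariant amplitude). [folklore] -/
theorem pairForm_comp_iso {a : Cfg → ℝ} (ha : ∀ (φ : torusGraph 2 4 ≃g torusGraph 2 4) (σ : Cfg), a (σ ∘ ⇑φ) = a σ)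
    (φ : torusGraph 2 4 ≃g torusGraph 2 4) (τ : Cfg) : pairForm a (τ ∘ ⇑φ) = pairForm a τ := by
  unfold pairForm
  symm
  rw [← Equiv.sum_comp φ.toEquiv]
  refine Finset.sum_congr rfl fun x _ => ?_
  rw [← Equiv.sum_comp φ.toEquiv]
  refine Finset.sum_congr rfl fun y _ => ?_
  have hadj : (torusGraph 2 4).Adj (φ x) (φ y) ↔ (torusGraph 2 4).Adj x y := φ.map_adj_iff
  have hx : φ.toEquiv x = φ x := rfl
  have hy : φ.toEquiv y = φ y := rfl
  have hupx : Function.update (τ ∘ ⇑φ) x 0 = Function.update τ (φ x) 0 ∘ ⇑φ := by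
    rw [show (⇑φ : V4 → V4) = ⇑φ.toEquiv from rfl, Function.update_comp_equiv τ φ.toEquiv (φ.toEquiv x) 0,
      Equiv.symm_apply_apply]
  have hupy : Function.update (τ ∘ ⇑φ) y 0 = Function.update τ (φ y) 0 ∘ ⇑φ := by
    rw [show (⇑φ : V4 → V4) = ⇑φ.toEquiv from rfl, Function.update_comp_equiv τ φ.toEquiv (φ.toEquiv y) 0,
      Equiv.symm_apply_apply]
  rw [hx, hy]
  by_cases h1 : (torusGraph 2 4).Adj x y <;> by_cases h2 : τ (φ x) = 1 <;> by_cases h3 : τ (φ y) = 1 <;>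
    simp [Function.comp_apply, hadj, h1, h2, h3, hupx, hupy, ha]

/-- the pair form is a class function on the weight-9 codes. [folklore] -/
theorem pairForm_decode_class {Δ : ℝ} {a : Cfg → ℝ} (ha : IsPerronSectorGroundAmplitude 4 Δ 0 a) {k : ℕ} (hk : k < 65536)
    (hpop : pop16 k = 9) : pairForm a (decode k) = pairForm a (decode (rep9 (cls9 k))) := by
  obtain ⟨-, hw, he, hact⟩ := check9_facts hk hpop
  conv_lhs => rw [← hact]
  exact decode_actCode_even_comp (pairForm a)
    (fun φ σ => pairForm_comp_iso (fun ψ τ => perronAmplitude_comp_iso 4 Δ 0 a ha ψ τ) φ σ) hw he _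

/-- at the representative: `D(decode (rep9 ρ)) = Σ_{(p,q) ∈ ordPairs ρ} (v p − v q)²`. [folklore] -/
theorem pairForm_decode_rep9 {Δ : ℝ} {a : Cfg → ℝ} (ha : IsPerronSectorGroundAmplitude 4 Δ 0 a) {ρ : ℕ} (hρ : ρ < 56) :
    pairForm a (decode (rep9 ρ)) = ((ordPairs ρ).map fun pq => (a (decode (rep8 pq.1)) - a (decode (rep8 pq.2))) ^ 2).sum := by
  obtain ⟨-, -, -, hch⟩ := rep9_facts hρ
  unfold ordPairs pairForm
  rw [list_sum_flatMap, list_sum_range, ← sum_V4_eq]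
  refine Finset.sum_congr rfl fun x _ => ?_
  rw [list_sum_filterMap₂, list_sum_range, ← sum_V4_eq]
  refine Finset.sum_congr rfl fun y _ => ?_
  by_cases hadj : (torusGraph 2 4).Adj x y
  · have hb : adj16 (siteEquiv x) (siteEquiv y) = true := (adj16_iff x y).2 hadj
    by_cases hx : Nat.testBit (rep9 ρ) (siteEquiv x) = true
    · by_cases hy : Nat.testBit (rep9 ρ) (siteEquiv y) = true
      · obtain ⟨hpx, hltx⟩ := hch (siteEquiv x) (siteEquiv x).isLt hx
        obtain ⟨hpy, hlty⟩ := hch (siteEquiv y) (siteEquiv y).isLt hy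
        rw [if_pos ⟨hadj, (decode_eq_one_iff _ _).2 hx, (decode_eq_one_iff _ _).2 hy⟩, hb, hx, hy]
        simp only [Bool.and_self, cond_true, Option.elim_some]
        rw [decode_clearBit _ _ hx, decode_clearBit _ _ hy, classValue ha hltx hpx, classValue ha hlty hpy]; ring
      · have hy' : Nat.testBit (rep9 ρ) (siteEquiv y) = false := by simpa using hy
        rw [if_neg (fun h => hy ((decode_eq_one_iff _ _).1 h.2.2)), hb, hx, hy']; rfl
    · have hx' : Nat.testBit (rep9 ρ) (siteEquiv x) = false := by simpa using hx
      rw [if_neg (fun h => hx ((decode_eq_one_iff _ _).1 h.2.1)), hb, hx']; simp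
  · have hb : adj16 (siteEquiv x) (siteEquiv y) = false := by
      cases h' : adj16 (siteEquiv x) (siteEquiv y)
      · rfl
      · exact absurd ((adj16_iff x y).1 h') hadj
    rw [if_neg (fun h => hadj h.1), hb]; simp

/-- **the graph form in class variables:** `Σ_σ a (A a) = ¼ Σ_{ρ<56} n9 ρ Σ_{(p,q) ∈ ordPairs ρ} (v p − v q)²`. [folklore] -/
theorem inner_fmOp_eq_classes {Δ : ℝ} {a : Cfg → ℝ} (ha : IsPerronSectorGroundAmplitude 4 Δ 0 a) :
    ∑ σ, a σ * fmOp (torusGraph 2 4) a σ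
      = (1/4 : ℝ) * ∑ ρ ∈ range 56, (n9 ρ : ℝ) * ((ordPairs ρ).map fun pq => (a (decode (rep8 pq.1)) - a (decode (rep8 pq.2))) ^ 2).sum := by
  rw [inner_fmOp_eq_pairForm, sum_config_eq_sum_range, ← sum_sector9]
  refine congrArg (fun s : ℝ => (1/4 : ℝ) * s) ?_
  refine Finset.sum_congr rfl fun k hk => ?_
  have hk' := mem_range.1 hk
  by_cases hp : pop16 k = 9
  · rw [if_pos hp, pairForm_decode_class ha hk' hp, pairForm_decode_rep9 ha (check9_facts hk' hp).1]
  · rw [if_neg hp, pairForm_decode_eq_zero ha hk' hp]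

end Summit.HubbardSuperconductivity.HubbardSuperconductivity.Theorems.AnisotropyChord.FourTorus
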